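import Summits.BirchSwinnertonDyer.BirchSwinnertonDyer.Theorems.ByReductionTypeAtTwoOrdKatoHalfAtTwoIsoValueInputTwo
import Summits.BirchSwinnertonDyer.BirchSwinnertonDyer.Theorems.ByReductionTypeAtTwoOrdKatoHalfAtTwoIsoKolyvaginCocycleNoTransverse
import Summits.BirchSwinnertonDyer.BirchSwinnertonDyer.Theorems.ByReductionTypeAtTwoOrdKatoHalfAtTwoIsoKThreeValueLine
import Summits.BirchSwinnertonDyer.BirchSwinnertonDyer.Theorems.ByReductionTypeAtTwoOrdKatoHalfAtTwoIsoRedTowerUnramifiedTwo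
import Summits.BirchSwinnertonDyer.BirchSwinnertonDyer.Theorems.ByReductionTypeAtTwoOrdKatoHalfAtTwoIsoLocalFrobeniusTransposition
import Summits.BirchSwinnertonDyer.BirchSwinnertonDyer.Theorems.ByReductionTypeAtTwoOrdKatoHalfAtTwoIsoPortGaloisSide
import Summits.BirchSwinnertonDyer.BirchSwinnertonDyer.Theorems.SmallImageMuTransferMuTransferX9KolyvaginValueAssembled
import Summits.BirchSwinnertonDyer.BirchSwinnertonDyer.Theorems.SmallImageMuTransferMuTransferX9StepTwoElement
import Summits.BirchSwinnertonDyer.BirchSwinnertonDyer.Theorems.ByReductionTypeAtTwoOrdKatoHalfAtTwoIsoKolyvaginCocycleRealValue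
import Summits.BirchSwinnertonDyer.BirchSwinnertonDyer.Theorems.ByReductionTypeAtTwoOrdKatoHalfAtTwoIsoRealPlaceLocalization
import Summits.BirchSwinnertonDyer.BirchSwinnertonDyer.Theorems.ByReductionTypeAtTwoOrdKatoHalfAtTwoIsoRealPlacePosDisc
import Summits.BirchSwinnertonDyer.BirchSwinnertonDyer.Theorems.ByReductionTypeAtTwoOrdKatoHalfAtTwoIsoKolyvaginRealCoset
import HarnessLib

/-!
# Route ByReductionTypeAtTwo, crux `OrdKatoHalfAtTwoIso` (stmt-BirchSwinnertonDyer-19573), line `steinberg-fibre-at-two`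
# (skeleton v11), stub `stub_coreA_posDisc : CoreTheoremAPosDiscTwo` — plan item (P2)(c): the KOLYVAGIN PACKAGE AT `p = 2`
# (κ_q of ONE transposition prime with its VALUE) **plus the vanishing of its real components at `0 < Δ`, `ℓ ≡ 1 (mod 4)`**

Seat `cruxlead-stmt-BirchSwinnertonDyer-19573-g5` (LEAD PROVER, MODE LINE; HOME `run/shared/lean/pub/bsd-2adic/`; `--supports`
stmt-BirchSwinnertonDyer-19573 as helper). THEOREMS ONLY (no definition, no named fact, no `sorry`). HONEST FRAMING (cell bsd-2adic):
BSD is not proved by any of this; the crux and the stub are NOT proved here.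

WHY. This is the package the `0 < Δ` assembly of H-K (brief (P4)) consumes in place of `exists_kolyvaginPackage_two` (p664682): the
same outputs (so the Δ<0 assembly `stub_HK_kolyvaginRankOneTwo`, p668150, ports line by line) AND the real-place clause that feeds
`hxinf` of Step 4 (`…StepFourOfXInf`, p685843) — valid for Kolyvagin primes `q` with `4 ∣ ℓ − 1`, i.e. Frobenius fixing `√−1`
(brief (P3): Rubin's `τ`, p682874). What remains for `CoreTheoremAPosDiscTwo` after this file: (P3) the sign-free Chebotarev step
exporting «`Fr` fixes `i`», and (P4) the assembly (T1 as is; this package; `…_of_xinf`; the pair transport p664102).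

References: B. Mazur, K. Rubin, Mem. AMS 799 (2004) §1.2, Prop. 1.3.2 [MazurRubin2004]; K. Rubin, *Euler Systems* (2000) §4.4–4.5
[Rubin2000]; K. Kato, Astérisque 295 (2004) §13.1 [Kato2004Asterisque]; tree p664682 (parent, verbatim), p688002, p687566, p686322,
`…RealPlaceLocalization.lean`.
-/

set_option linter.dupNamespace false
set_option autoImplicit false

noncomputable section

open CategoryTheory Function Finset Polynomial
open scoped NumberField Pointwise
open Field IsDedekindDomain
open Literature.NumberTheory.GaloisRepresentations
open Literature.NumberTheory.GaloisCohomology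
open Literature.NumberTheory.EllipticCurves
open Literature.NumberTheory.EllipticCurves.ZpExtension
open Literature.NumberTheory.EllipticCurves.Kato2004
open Literature.NumberTheory.EllipticCurves.Kato2004.EulerSystemValues
open Rat.HeightOneSpectrum
open Summit.BirchSwinnertonDyer.Rank1Residual.GaloisImage
open Summit.BirchSwinnertonDyer.BirchSwinnertonDyer.Rank1Residual

namespace Summit.BirchSwinnertonDyer.BirchSwinnertonDyer.Theorems.SteinbergFibreAtTwo

variable (W : WeierstrassCurve ℚ) [W.IsElliptic] [W.IsGloballyMinimal]
  [ContinuousSMul ℤ_[2] (W.tateModule 2)]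
  [Module.Free ℤ_[2] (W.tateModule 2)] [Module.Finite ℤ_[2] (W.tateModule 2)]
  (κ : ZpExtension ℚ 2) (hκ : κ.IsCyclotomic) (γ : absoluteGaloisGroup ℚ) (I : IwasawaH1Data W 2 κ γ)

/-- **THE KOLYVAGIN PACKAGE AT `p = 2` — WITH THE REAL-PLACE VANISHING** (lead g5; plan item (P2)(c) of
`STUB-BRIEF-stub_coreA_posDisc.md`). Verbatim `exists_kolyvaginPackage_two` (p664682: tame class H16₂ → value input → hp2-free
Kolyvagin cocycle → K3 value line; credit lead g0 / wave-4 workers / x10 / k6-g3) built over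
`exists_kolyvaginCocycle_value_noTransverse_realZero` (p688002) instead of `…_noTransverse`, with ONE MORE OUTPUT CLAUSE on the
Kolyvagin cocycle `c`: **if `0 < Δ_W` and `4 ∣ ℓ − 1` then every shift `T^[k] [c]` is locally trivial at the real place**
(`loc_{Sum.inl w} (T^[k] [c]) = 0` for all `w`, `k`) — exactly the hypothesis `hxinf` of
`StepFour.convCoeff_eq_zero_of_qTermIdentity_modPTwist_two_of_xinf` (p685843). Proof of the clause: a complex conjugation `cc`
at `w` acts trivially on `E[2]` at `0 < Δ` (`smul_eq_self_of_isComplexConjugation_of_Δ_pos`, p686322), hence on `𝒯_J(E)`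
(`cc ∈ ker κ`), is an involution outside `Gal(ℚ̄/ℚ(μ_ℓ))` (`not_mem_rootsOfUnityFixer_of_isComplexConjugation`, p687566), so
`c(cc) = 0` by the real-zero clause, and `localization_inl_iterate_shiftH1_eq_zero_of_forall` (`…RealPlaceLocalization`) concludes.
[cite: MazurRubin2004, Prop. 1.3.2 and §3] [cite: Rubin2000, Def. 4.4.4, Lemma 4.4.2, Thm. 4.5.1] -/
theorem exists_kolyvaginPackage_two_realZero (h2 : W.HasSurjectiveModNGaloisRep 2) {s : I.H}
    (hES : IsEulerSystemClassTwo W hκ I s) :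
    ∃ S₀ : Set (HeightOneSpectrum (𝓞 ℚ)), S₀.Finite ∧
      ∀ (a : ℕ) (κ' : κ.twistTower (W.torsionGaloisModule ((2 : ℕ) : ℤ))
          (fun P : WeierstrassCurve.geomTorsion W ((2 : ℕ) : ℤ) => AddSubgroup.torsionBy.nsmul P)),
        (κ.towerShift (W.torsionGaloisModule ((2 : ℕ) : ℤ))
          (fun P : WeierstrassCurve.geomTorsion W ((2 : ℕ) : ℤ) => AddSubgroup.torsionBy.nsmul P))^[a] κ' =
            I.redTower s →
      ∀ (d J : ℕ), J ≤ 2 ^ d →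
      ∀ (Φ : contOneCocycles (W.modPTwist 2 κ J).toTopRep),
        oneCocycleClass (W.modPTwist 2 κ J).toTopRep Φ = κ'.1 J →
      ∀ (q : HeightOneSpectrum (𝓞 ℚ)), q ∉ S₀ →
      ∀ [NeZero ((primesEquiv q : Nat.Primes) : ℕ)] [Fact (((primesEquiv q : Nat.Primes) : ℕ)).Prime]
        [NeZero ((((primesEquiv q : Nat.Primes) : ℕ) : ℕ) : q.adicCompletion ℚ)]
        [(rootsOfUnityFixer ℚ ((primesEquiv q : Nat.Primes) : ℕ)).Normal]
        [Fintype (absoluteGaloisGroup ℚ ⧸ rootsOfUnityFixer ℚ ((primesEquiv q : Nat.Primes) : ℕ))],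
      ∀ 𝔓 ∈ q.primesAbove, ∀ (Fr : absoluteGaloisGroup ℚ), IsArithFrobAt (𝓞 ℚ) Fr 𝔓 →
        WeierstrassCurve.galoisRepTorsion W 2 (Fr * Fr) = 1 → WeierstrassCurve.galoisRepTorsion W 2 Fr ≠ 1 →
        Fr ∈ κ.layerSubgroup d → Fr ∉ κ.layerSubgroup (d + 1) →
      galoisCohomology.localization (W.modPTwist 2 κ J) (Sum.inr q) 1 ((I.redTower s).1 J) ∈
        DiscreteGaloisModule.unramifiedSubgroup (GaloisRep.toLocal q (W.modPTwist 2 κ J)) 1 ∧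
      ∃ (c : contOneCocycles (W.modPTwist 2 κ J).toTopRep)
        (τq r : absoluteGaloisGroup (q.adicCompletion ℚ)),
        τq ∈ absInertia (q.adicCompletion ℚ) ∧
        (∀ u : (ZMod ((primesEquiv q : Nat.Primes) : ℕ))ˣ,
          u ∈ Subgroup.zpowers (modPCyclotomicCharacterZMod (q.adicCompletion ℚ)
            ((primesEquiv q : Nat.Primes) : ℕ) τq)) ∧
        (∀ w : HeightOneSpectrum (𝓞 ℚ), w ≠ q → ((2 : ℕ) : 𝓞 ℚ) ∉ w.asIdeal →
          GaloisRep.IsUnramifiedAt w (W.torsionGaloisModule ((2 : ℕ) : ℤ)) →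
          galoisCohomology.localization (W.modPTwist 2 κ J) (Sum.inr w) 1
              (oneCocycleClass (W.modPTwist 2 κ J).toTopRep c) ∈
            DiscreteGaloisModule.unramifiedSubgroup (GaloisRep.toLocal w (W.modPTwist 2 κ J)) 1) ∧
        (0 < W.Δ → 4 ∣ ((primesEquiv q : Nat.Primes) : ℕ) - 1 →
          ∀ (w : NumberField.InfinitePlace ℚ) (k : ℕ),
            galoisCohomology.localization (W.modPTwist 2 κ J) (Sum.inl w) 1
              ((κ.shiftH1 (W.torsionGaloisModule ((2 : ℕ) : ℤ))
                (fun P : WeierstrassCurve.geomTorsion W ((2 : ℕ) : ℤ) => AddSubgroup.torsionBy.nsmul P) J)^[k]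
                (oneCocycleClass (W.modPTwist 2 κ J).toTopRep c)) = 0) ∧
        IsAbsArithFrob r ∧
        c.1 (absGaloisRestrict ℚ (q.adicCompletion ℚ) τq) =
          (shiftEnd (WeierstrassCurve.geomTorsion W ((2 : ℕ) : ℤ)) J ^ a)
            (W.modPTwist 2 κ J (absGaloisRestrict ℚ (q.adicCompletion ℚ) r)
              (Φ.1 (absGaloisRestrict ℚ (q.adicCompletion ℚ) r)) -
             Φ.1 (absGaloisRestrict ℚ (q.adicCompletion ℚ) r)) := by
  classical
  haveI : Fact (2 : ℕ).Prime := ⟨Nat.prime_two⟩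
  obtain ⟨S₀, hS₀, hmain⟩ := exists_tameCocycle_valueInput_two W κ hκ γ I hES
  refine ⟨S₀, hS₀, ?_⟩
  intro a κ' hκ' d J hJd Φ hΦ q hq _ _ _ _ _ 𝔓 h𝔓 Fr hFr hT hT1 hFrd hFrd'
  -- levels: `J ≤ 2ᵈ`, `L = 2^{d+2}`, `J + 2^{d+1} ≤ L`, `J ≤ 2·2ᵈ`
  have h2d : 2 ^ (d + 2) = 2 ^ d + 2 ^ d + 2 ^ (d + 1) := by rw [pow_succ, pow_succ]; ring
  have hJL : J ≤ 2 ^ (d + 2) := by rw [h2d]; omega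
  have hJL' : J + 2 ^ (d + 1) ≤ 2 ^ (d + 2) := by rw [h2d]; omega
  have hJ2 : J ≤ 2 * 2 ^ d := by omega
  obtain ⟨hqp, hunr, hdvd, u, y', hu, hact, hyI', hrel⟩ := hmain q hq h𝔓 hFr hT hFrd hFrd'
  have hqp' : ((2 : ℕ) : 𝓞 ℚ) ∉ q.asIdeal := hqp
  refine ⟨RedTowerTwo.localization_redTower_mem_unramifiedSubgroup W κ hκ γ I hES hqp' hunr J, ?_⟩
  -- a cocycle of `𝐳̄₁` at level `L` and the norm relation
  obtain ⟨φ, hφ⟩ := oneCocycleClass_surjective _ ((I.redTower s : ∀ J : ℕ, galoisCohomology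
    (κ.twistModP (W.torsionGaloisModule ((2 : ℕ) : ℤ)) IwasawaH1Data.torsion_nsmul_eq_zero J) 1)
    (2 ^ (d + 2)))
  obtain ⟨ψ', hψ', hnorm, hψJ⟩ := hrel φ hφ
  -- H-F: `E(ℚ^{ab})[2] = 0` for `ρ̄₂` onto
  have hfix : ∀ m : WeierstrassCurve.geomTorsion W ((2 : ℕ) : ℤ),
      (∀ g ∈ rootsOfUnityFixer ℚ ((primesEquiv q : Nat.Primes) : ℕ),
        W.torsionGaloisModule ((2 : ℕ) : ℤ) g m = m) → m = 0 := fun m hm =>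
    geomTorsion_eq_zero_of_fixed_of_commutator_le_two W h2 (commutator_le_rootsOfUnityFixer ℚ _) m
      fun σ hσ => by rw [← WeierstrassCurve.torsionGaloisModule_apply_apply]; exact hm σ hσ
  -- the hp2-free Kolyvagin cocycle with its value (wave 4, M1)
  obtain ⟨σ, hσ, τq, hτq, hτqσ, hgen, -, c, hx, -, hreal, r, hr, -, a', hval, hkey⟩ :=
    KolyvaginTwist.exists_kolyvaginCocycle_value_noTransverse_realZero κ (W.torsionGaloisModule ((2 : ℕ) : ℤ))
      IwasawaH1Data.torsion_nsmul_eq_zero J q hfix hqp hunr hdvd hJL y' hyI' ψ' hnorm (hψJ hJL hJ2)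
  refine ⟨c, τq, r, hτq, hgen, hx, fun hΔ h4 w k => ?_, hr, ?_⟩
  · -- NEW (lead g5, stub_coreA_posDisc (P2)): at `0 < Δ` and `ℓ ≡ 1 (mod 4)` every shift of the Kolyvagin class is
    -- locally trivial at the real place — the hypothesis `hxinf` of `…_modPTwist_two_of_xinf` (p685843)
    refine localization_inl_iterate_shiftH1_eq_zero_of_forall W κ J c w (fun cc hcc => ?_) k
    have hℓ2 : 2 < ((primesEquiv q : Nat.Primes) : ℕ) :=
      lt_of_le_of_ne (primesEquiv q).2.two_le (TameClass.primesEquiv_ne_of_natCast_not_mem hqp').symm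
    have hcc' : IsComplexConjugation (Rat.castHom ℝ) cc := by
      have he : (NumberField.InfinitePlace.embedding_of_isReal (NumberField.IsTotallyReal.isReal w) : ℚ →+* ℝ) = Rat.castHom ℝ :=
        Subsingleton.elim _ _
      rw [← he]
      exact hcc
    have hker : cc ∈ κ.kerSubgroup := κ.mem_kerSubgroup_of_isComplexConjugation hcc
    refine hreal cc (fun x => funext fun i => IwasawaH1Data.torsion_nsmul_eq_zero (x i)) (fun x => ?_) (by rw [← pow_two]; exact hcc.sq_eq_one)
      (KolyvaginTwist.not_mem_rootsOfUnityFixer_of_isComplexConjugation hℓ2 hcc') h4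
    change W.modPTwist 2 κ J cc x = x
    rw [modPTwist_apply_of_mem_kerSubgroup W 2 κ J hker x]
    funext i
    exact smul_eq_self_of_isComplexConjugation_of_Δ_pos W hcc hΔ (x i)
  -- the local Frobenius `res r`: a transposition of depth `d`, its slotwise action `τ` with `τ² = 1`
  set rr := absGaloisRestrict ℚ (q.adicCompletion ℚ) r with hrrdef
  obtain ⟨hrr2, -, hrrlayer⟩ :=
    LocalFrobenius.galoisRepTorsion_absGaloisRestrict_of_isArithFrobAt W κ hunr hqp' h𝔓 hFr hT hT1 hr
  have hrrd : rr ∈ κ.layerSubgroup d := (hrrlayer d).2 hFrd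
  let τ : WeierstrassCurve.geomTorsion W ((2 : ℕ) : ℤ) →ₗ[ℤ] WeierstrassCurve.geomTorsion W ((2 : ℕ) : ℤ) :=
    (DistribSMul.toAddMonoidHom (WeierstrassCurve.geomTorsion W ((2 : ℕ) : ℤ)) rr).toIntLinearMap
  have hτx : ∀ (n : ℕ) (x : Fin n → WeierstrassCurve.geomTorsion W ((2 : ℕ) : ℤ)),
      τ.compLeft (Fin n) x = fun i => rr • x i := fun _ _ => rfl
  have hτ : τ * τ = 1 := by
    refine LinearMap.ext fun P => ?_
    change rr • (rr • P) = P
    rw [← mul_smul]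
    exact forall_smul_eq_of_galoisRepTorsion_eq_one W 2 hrr2 P
  -- the key relation in K3 shape: `(φ̃ τ − 1) a' = −(φ̃ − 1)² φ(res r)`
  have hM : ∀ x : WeierstrassCurve.geomTorsion W ((2 : ℕ) : ℤ), 2 • x = 0 := IwasawaH1Data.torsion_nsmul_eq_zero
  have hkey' : (unipotentPow (WeierstrassCurve.geomTorsion W ((2 : ℕ) : ℤ)) (2 ^ (d + 2)) (2 ^ d * u) *
        τ.compLeft (Fin (2 ^ (d + 2))) - 1) a' =
      -((unipotentPow (WeierstrassCurve.geomTorsion W ((2 : ℕ) : ℤ)) (2 ^ (d + 2)) (2 ^ d * u) - 1)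
        ((unipotentPow (WeierstrassCurve.geomTorsion W ((2 : ℕ) : ℤ)) (2 ^ (d + 2)) (2 ^ d * u) - 1)
          (φ.1 rr))) := by
    have hact' : ∀ x : Fin (2 ^ (d + 2)) → WeierstrassCurve.geomTorsion W ((2 : ℕ) : ℤ),
        κ.twistModP (W.torsionGaloisModule ((2 : ℕ) : ℤ)) IwasawaH1Data.torsion_nsmul_eq_zero (2 ^ (d + 2)) rr x =
          unipotentPow (WeierstrassCurve.geomTorsion W ((2 : ℕ) : ℤ)) (2 ^ (d + 2)) (2 ^ d * u)
            (fun i => rr • x i) := fun x => hact r hr x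
    have h1 : (unipotentPow (WeierstrassCurve.geomTorsion W ((2 : ℕ) : ℤ)) (2 ^ (d + 2)) (2 ^ d * u) *
        τ.compLeft (Fin (2 ^ (d + 2)))) a' =
        κ.twistModP (W.torsionGaloisModule ((2 : ℕ) : ℤ)) IwasawaH1Data.torsion_nsmul_eq_zero (2 ^ (d + 2)) rr a' := by
      rw [Module.End.mul_apply, hτx, hact']
    have hψ'' : ψ'.1 rr =
        (unipotentPow (WeierstrassCurve.geomTorsion W ((2 : ℕ) : ℤ)) (2 ^ (d + 2)) (2 ^ d * u) - 1)
          ((unipotentPow (WeierstrassCurve.geomTorsion W ((2 : ℕ) : ℤ)) (2 ^ (d + 2)) (2 ^ d * u) - 1)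
            (φ.1 rr)) := hψ' rr
    rw [LinearMap.sub_apply, Module.End.one_apply, h1, hkey, hψ'']
  -- the coboundary `φ mod T^J − S^a Φ = (res r)·b − b`, and `(res r)` acts slotwise at level `J ≤ 2ᵈ`
  obtain ⟨b, hb⟩ := KolyvaginTwist.exists_coboundary_apply_of_towerShift_iterate_eq κ
    (W.torsionGaloisModule ((2 : ℕ) : ℤ)) IwasawaH1Data.torsion_nsmul_eq_zero κ' (I.redTower s) hκ' hJL Φ hΦ φ hφ
  have htwJ : ∀ x : Fin J → WeierstrassCurve.geomTorsion W ((2 : ℕ) : ℤ),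
      W.modPTwist 2 κ J rr x = τ.compLeft (Fin J) x := fun x => by
    rw [hτx]
    exact modPTwist_apply_of_mem_layerSubgroup_of_le W 2 κ hJd hrrd x
  have hcob : (fun i : Fin J => φ.1 rr (Fin.castLE (le_trans (Nat.le_add_right J (2 ^ (d + 1))) hJL') i)) -
      (shiftEnd (WeierstrassCurve.geomTorsion W ((2 : ℕ) : ℤ)) J ^ a) (Φ.1 rr) = τ.compLeft (Fin J) b - b := by
    rw [← htwJ]
    exact hb rr
  -- K3: the division and the coboundary correction
  have hK3 := KThree.neg_castLE_eq_shiftEnd_pow_compLeft_sub hM d u hu τ hτ hJd hJL' a' (φ.1 rr) hkey' a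
    (Φ.1 rr) b hcob
  rw [hval]
  rw [htwJ]
  exact hK3

end Summit.BirchSwinnertonDyer.BirchSwinnertonDyer.Theorems.SteinbergFibreAtTwo

end
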